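import Literature.AlgebraicGeometry.ComplexMultiplication.EndomorphismFieldSubfieldSignature
import Literature.AlgebraicGeometry.ComplexMultiplication.EndomorphismFieldSubfieldSignatureReflexField
import Literature.NumberTheory.ComplexMultiplication.CMTypeHarrisTaylorSignatureReflexField
import Literature.AlgebraicGeometry.Motives.CMTorusMonomialCharacters
import HarnessLib

/-!
# The Kottwitz condition of signature `((1, n−1)_{φ₀}, (0, n)_{φ ∈ Φ₀ ∖ {φ₀}})` (Rapoport–Smithling–Zhang,
# Harris–Taylor) on Shimura's pair, VERBATIM on `Lie(A)`, and the reflex field of its CM points: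
# `σ₀(F) ⊆ K*`, `[K* : ℚ] ≥ 2 dim A`, and `K* = σ₀(F) ≅ F` for `K₀/ℚ` normal

Topic `Literature/AlgebraicGeometry/ComplexMultiplication` (family `hodge`, lane `lit-hodgefound`; the ALGEBRAIC
carrier `Motives.AbelianVariety ℂ`, Shimura's pairs `(A, ι : F →+* A.endAlgebra)`, `[F : ℚ] = 2 dim A`, THE type
`Φ = cmTypeOfPair ι hF`, a subfield `K₀ ≤ F`, `n = [F : K₀]`, `m_ψ = #{φ ∈ Φ ∣ φ|_{K₀} = ψ}`).  Sequel of
`EndomorphismFieldSubfieldSignature` (g27-#1: a family of multiplicities is THE signature iff the characteristic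
polynomials `char(ι(a) | Lie A)`, `a ∈ K₀`, are `∏_ψ (X − ψ(a))^{m_ψ}`), `EndomorphismFieldSubfieldSignatureReflexField`
(g27-#2: the Harris–Taylor / RSZ signature in multiplicity form `m_{φ₀} = 1`, `m_ψ ∈ {0, n}` for `ψ ∉ {φ₀, φ̄₀}`) and
the field-level `NumberTheory/ComplexMultiplication/CMTypeHarrisTaylorSignatureReflexField` (g27-#4: the reflex field
of such a type contains `σ₀(K)`, and equals it when `Aut(ℂ/φ₀(k₀))` fixes `Hom(k₀, ℂ)`).  Here RSZ's DISPLAYED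
Kottwitz condition — indexed by a CM type `Φ₀` of `K₀` containing `φ₀` — is read on `Lie(A)` and the reflex-field
statements are transported to the pair.

PRINTED STATEMENTS.  M. Rapoport, B. Smithling, W. Zhang, *Arithmetic diagonal cycles on unitary Shimura varieties*
(Compositio 2020) [RapoportSmithlingZhang2017], §3.2 (held text `paper:arxiv-1710.06962`, chunk p0011 L29): «`A` is
an abelian scheme over `S` with an `F`-action `ι : F → End⁰(A)` satisfying the Kottwitz condition of signature
`((1, n−1)_{φ₀}, (0, n)_{φ ∈ Φ ∖ {φ₀}})`, i.e. `char(ι(a) | Lie A) = (T − φ₀(a))(T − φ̄₀(a))^{n−1}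
∏_{φ ∈ Φ ∖ {φ₀}} (T − φ̄(a))^n` for all `a ∈ O_F`»; §3.1: «the reflex field `E` … contains `φ₀(F)`».  M. Harris,
R. Taylor (2001) [HarrisTaylor2001], Introduction p. 2 (chunk p0010 L24): «`G₁(ℝ) ≅ U(1, n−1) × U(0, n)^{[F⁺:ℚ]−1}`»,
Lemma III.1.2 (chunk p0084: compatibility through `tr(b | Lie A)`).  B. Howard (2012) [Howard2012] §3.1:
«`K_Φ = φ^{sp}(K)`» (`K₀` imaginary quadratic).  G. Shimura (1998) [Shimura1998] §5.2 p. 39 («`δι(α)ωᵢ = α^{φᵢ}ωᵢ`»),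
§8.3 Prop. 28.

WHAT IS PROVED (`K₀ : IntermediateField ℚ F`, `Φ₀ : CMType K₀`, `φ₀ ∈ Φ₀`, `n = finrank K₀ F`):

* §1 **`forall_charpoly_lieAction_eq_rsz_iff`** — RSZ'S KOTTWITZ CONDITION HOLDS ON `Lie(A)` for every `a ∈ K₀` IFF
  `m_{φ₀} = 1` and `m_φ = 0` for every `φ ∈ Φ₀ ∖ {φ₀}` (then `m_{φ̄₀} = n − 1`, `m_φ̄ = n`); `card_fibre_eq_zero_or_of_rsz`
  (these multiplicities are the Harris–Taylor hypotheses of g27-#2/#4: `m_ψ ∈ {0, n}` off `{φ₀, φ̄₀}`).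
* §2 the CM points of this signature (`F ⊆ End⁰(A)` a CM field, `n ≥ 3`, `σ₀` the special element above `φ₀`):
  **`fieldRange_special_le_traceField_cmTypeOfPair_of_harrisTaylor`** (`σ₀(F) ⊆ K*`),
  **`two_mul_dim_le_finrank_traceField_of_harrisTaylor`** (`2 dim A ≤ [K* : ℚ]`), and for `K₀/ℚ` NORMAL
  **`traceField_cmTypeOfPair_eq_fieldRange_of_harrisTaylor`** (`K* = σ₀(F)`),
  `finrank_traceField_cmTypeOfPair_eq_two_mul_dim_of_harrisTaylor` (`[K* : ℚ] = 2 dim A`),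
  `nonempty_ringEquiv_traceField_cmTypeOfPair_of_harrisTaylor` (`K* ≅ F`); the same from RSZ's displayed condition:
  `fieldRange_special_le_traceField_cmTypeOfPair_of_rsz`, `traceField_cmTypeOfPair_eq_fieldRange_of_rsz`.

Theorems only; no definition, no named fact, no `sorry` (net debt 0); axioms `propext`, `Classical.choice`,
`Quot.sound`.

## References
* [RapoportSmithlingZhang2017] M. Rapoport, B. Smithling, W. Zhang, *Arithmetic diagonal cycles on unitary Shimura
  varieties*, Compositio Math. 156 (2020), §3.1–3.2, §4.1.
* [HarrisTaylor2001] M. Harris, R. Taylor, *The Geometry and Cohomology of Some Simple Shimura Varieties* (2001),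
  Introduction p. 2, §I.7, Lemma III.1.2.
* [Howard2012] B. Howard, Ann. of Math. (2) 176 (2012), §3.1.
* [Shimura1998] G. Shimura, *Abelian Varieties with Complex Multiplication and Modular Functions* (1998), §5.2 p. 39,
  §8.3 Prop. 28.
* [Kottwitz1992] R. E. Kottwitz, J. Amer. Math. Soc. 5 (1992), §5 p. 390.

## Provenance

Lane `lit-hodgefound` (HOME `run/shared/lean/pub/lit-hodgefound/`), prover seat `lit-hodgefound-p11` (gen 27),
self-proposed row g27-#5 (INBOX claim 2026-08-27).
-/

noncomputable section

namespace Literature.AlgebraicGeometry.ComplexMultiplication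

open scoped Classical Polynomial Pointwise
open CategoryTheory NumberField Module Polynomial
open Literature.AlgebraicGeometry.Motives
open Literature.AlgebraicGeometry.Motives.CMTorusChar (univ_eq_union_map disjoint_map)
open Literature.NumberTheory.ComplexMultiplication

namespace EndFieldFullDegree

variable {F : Type} [Field F] [NumberField F] {A : AbelianVariety ℂ}
  (ιF : F →+* A.endAlgebra) (hF : finrank ℚ F = 2 * A.dim) (K₀ : IntermediateField ℚ F)

/-- The multiplicity `m_ψ` of THE type as a set cardinality (the spelling of the field-level files). [folklore] -/
private theorem ncard_inter_fibre_eq_card_fibre_ht5 (ψ : K₀ →+* ℂ) :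
    {φ : F →+* ℂ | φ ∈ (cmTypeOfPair ιF hF).1 ∧ φ.comp (algebraMap K₀ F) = ψ}.ncard =
      Fintype.card {σ : (cmTypeOfPair ιF hF).1 // σ.1.comp (algebraMap K₀ F) = ψ} := by
  rw [← Nat.card_coe_set_eq, Fintype.card_eq_nat_card]
  exact Nat.card_congr
    (Equiv.subtypeSubtypeEquivSubtypeInter (fun φ : F →+* ℂ => φ ∈ (cmTypeOfPair ιF hF).1)
      (fun φ => φ.comp (algebraMap K₀ F) = ψ)).symm

/-! ### §1 RSZ's Kottwitz condition `((1, n−1)_{φ₀}, (0, n)_{φ ∈ Φ₀ ∖ {φ₀}})` on `Lie(A)` -/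

/-- The RSZ exponent function `r` and its product: `∏_ψ (X − ψ(a))^{r_ψ} = (X − φ₀(a))·(X − φ̄₀(a))^{n−1}·
∏_{φ ∈ Φ₀ ∖ {φ₀}} (X − φ̄(a))ⁿ` (`Hom(K₀, ℂ) = Φ₀ ⊔ Φ̄₀`). [folklore] -/
private theorem prod_pow_rsz_eq (Φ₀ : CMType K₀) {φ₀ : K₀ →+* ℂ} (hφ₀ : φ₀ ∈ Φ₀.1) (n : ℕ) (a : K₀) :
    ∏ ψ : K₀ →+* ℂ, (X - C (ψ a : ℂ)) ^
        (if ψ ∈ Φ₀.1 then (if ψ = φ₀ then 1 else 0)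
          else (if ψ = ComplexEmbedding.conjugate φ₀ then n - 1 else n)) =
      (X - C (φ₀ a : ℂ)) * ((X - C (ComplexEmbedding.conjugate φ₀ a : ℂ)) ^ (n - 1) *
        ∏ φ ∈ Φ₀.1.toFinset.erase φ₀, (X - C (ComplexEmbedding.conjugate φ a : ℂ)) ^ n) := by
  have hT : ∀ ψ : K₀ →+* ℂ, ψ ∈ Φ₀.1.toFinset ↔ ComplexEmbedding.conjugate ψ ∉ Φ₀.1.toFinset := fun ψ => by
    rw [Set.mem_toFinset, Set.mem_toFinset]; exact Φ₀.2 ψ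
  have hinv := ComplexEmbedding.involutive_conjugate K₀
  have hφ₀T : φ₀ ∈ Φ₀.1.toFinset := Set.mem_toFinset.2 hφ₀
  rw [univ_eq_union_map _ hinv hT, Finset.prod_union (disjoint_map _ hinv hT), Finset.prod_map]
  simp only [Function.Embedding.coeFn_mk]
  congr 1
  · -- over `Φ₀`: only `φ₀` contributes, with exponent `1`
    rw [← Finset.mul_prod_erase _ _ hφ₀T, if_pos hφ₀, if_pos rfl, pow_one, Finset.prod_eq_one, mul_one]
    intro ψ hψ
    obtain ⟨hne, hmem⟩ := Finset.mem_erase.1 hψ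
    rw [if_pos (Set.mem_toFinset.1 hmem), if_neg hne, pow_zero]
  · -- over `Φ̄₀`: `φ̄₀` with exponent `n − 1`, the others with `n`
    rw [← Finset.mul_prod_erase _ _ hφ₀T, if_neg ((Φ₀.2 φ₀).1 hφ₀), if_pos rfl]
    congr 1
    refine Finset.prod_congr rfl fun ψ hψ => ?_
    obtain ⟨hne, hmem⟩ := Finset.mem_erase.1 hψ
    rw [if_neg ((Φ₀.2 ψ).1 (Set.mem_toFinset.1 hmem)), if_neg fun h => hne (hinv.injective h)]

/-- **RSZ'S KOTTWITZ CONDITION OF SIGNATURE `((1, n−1)_{φ₀}, (0, n)_{φ ∈ Φ₀ ∖ {φ₀}})` ON SHIMURA'S PAIR**: for a CM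
type `Φ₀` of `K₀` and `φ₀ ∈ Φ₀`, the identity «`char(ι(a) | Lie A) = (T − φ₀(a))(T − φ̄₀(a))^{n−1}
∏_{φ ∈ Φ₀ ∖ {φ₀}} (T − φ̄(a))ⁿ`» holds for EVERY `a ∈ K₀` (`n = [F : K₀]`) iff THE type of `(A, ι)` has `m_{φ₀} = 1`
and `m_φ = 0` for every `φ ∈ Φ₀ ∖ {φ₀}` (and then `m_{φ̄₀} = n − 1`, `m_φ̄ = n`) — g27-#1's «`V ≅ W` iff
`det_V = det_W`» in characteristic-polynomial form at the RSZ multiplicity function.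
[cite: RapoportSmithlingZhang2017, §3.2 (the Kottwitz condition of signature `((1, n−1)_{φ₀}, (0, n)_{φ ∈ Φ ∖ {φ₀}})`)]
[cite: Kottwitz1992, §5 (p. 390)] [cite: HarrisTaylor2001, Lemma III.1.2] -/
theorem forall_charpoly_lieAction_eq_rsz_iff (Φ₀ : CMType K₀) {φ₀ : K₀ →+* ℂ} (hφ₀ : φ₀ ∈ Φ₀.1) :
    (∀ a : K₀, (Motives.AbelianVariety.lieAction A (ιF (algebraMap K₀ F a))).charpoly =
        (X - C (φ₀ a : ℂ)) * ((X - C (ComplexEmbedding.conjugate φ₀ a : ℂ)) ^ (finrank K₀ F - 1) *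
          ∏ φ ∈ Φ₀.1.toFinset.erase φ₀, (X - C (ComplexEmbedding.conjugate φ a : ℂ)) ^ finrank K₀ F)) ↔
      Fintype.card {σ : (cmTypeOfPair ιF hF).1 // σ.1.comp (algebraMap K₀ F) = φ₀} = 1 ∧
        ∀ φ ∈ Φ₀.1, φ ≠ φ₀ →
          Fintype.card {σ : (cmTypeOfPair ιF hF).1 // σ.1.comp (algebraMap K₀ F) = φ} = 0 := by
  have hsum := card_fibre_add_card_fibre_conjugate_eq_finrank ιF hF K₀
  set r : (K₀ →+* ℂ) → ℕ := fun ψ =>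
    if ψ ∈ Φ₀.1 then (if ψ = φ₀ then 1 else 0)
      else (if ψ = ComplexEmbedding.conjugate φ₀ then finrank K₀ F - 1 else finrank K₀ F) with hr
  have key : ∀ a : K₀, ∏ ψ : K₀ →+* ℂ, (X - C (ψ a : ℂ)) ^ r ψ =
      (X - C (φ₀ a : ℂ)) * ((X - C (ComplexEmbedding.conjugate φ₀ a : ℂ)) ^ (finrank K₀ F - 1) *
        ∏ φ ∈ Φ₀.1.toFinset.erase φ₀, (X - C (ComplexEmbedding.conjugate φ a : ℂ)) ^ finrank K₀ F) :=
    fun a => prod_pow_rsz_eq K₀ Φ₀ hφ₀ (finrank K₀ F) a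
  have hiff := forall_charpoly_lieAction_eq_prod_pow_iff ιF hF K₀ r
  constructor
  · intro h
    have hm := hiff.1 fun a => (h a).trans (key a).symm
    have hmψ : ∀ ψ, r ψ = Fintype.card {σ : (cmTypeOfPair ιF hF).1 // σ.1.comp (algebraMap K₀ F) = ψ} :=
      fun ψ => congrFun hm ψ
    refine ⟨?_, fun φ hφ hφne => ?_⟩
    · rw [← hmψ φ₀, hr]
      simp only [if_pos hφ₀, if_true]
    · rw [← hmψ φ, hr]
      simp only [if_pos hφ, if_neg hφne]
  · rintro ⟨h1, h0⟩ a
    rw [← key a]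
    refine hiff.2 ?_ a
    funext ψ
    rw [hr]
    simp only
    by_cases hψ : ψ ∈ Φ₀.1
    · rw [if_pos hψ]
      by_cases hψ0 : ψ = φ₀
      · subst hψ0
        rw [if_pos rfl, h1]
      · rw [if_neg hψ0, h0 ψ hψ hψ0]
    · rw [if_neg hψ]
      have hψbar : ComplexEmbedding.conjugate ψ ∈ Φ₀.1 := by
        by_contra h
        exact hψ ((Φ₀.2 ψ).2 h)
      have hs := hsum ψ
      by_cases hψ1 : ψ = ComplexEmbedding.conjugate φ₀
      · subst hψ1
        rw [if_pos rfl]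
        rw [ComplexEmbedding.involutive_conjugate K₀ φ₀, h1] at hs
        omega
      · rw [if_neg hψ1]
        have hne' : ComplexEmbedding.conjugate ψ ≠ φ₀ := fun h =>
          hψ1 (by rw [← h]; exact (ComplexEmbedding.involutive_conjugate K₀ ψ).symm)
        rw [h0 _ hψbar hne'] at hs
        omega

/-- **RSZ's multiplicities are the Harris–Taylor hypotheses of g27-#2/#4**: `m_{φ₀} = 1` and `m_φ = 0` on
`Φ₀ ∖ {φ₀}` give `m_ψ ∈ {0, n}` for every `ψ ∉ {φ₀, φ̄₀}` (`ψ ∈ Φ₀ ⟹ 0`; `ψ̄ ∈ Φ₀ ∖ {φ₀} ⟹ m_ψ = n − 0`).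
[cite: RapoportSmithlingZhang2017, §3.2 and §4.1] -/
theorem card_fibre_eq_zero_or_of_rsz (Φ₀ : CMType K₀) {φ₀ : K₀ →+* ℂ}
    (h0 : ∀ φ ∈ Φ₀.1, φ ≠ φ₀ → Fintype.card {σ : (cmTypeOfPair ιF hF).1 // σ.1.comp (algebraMap K₀ F) = φ} = 0)
    (ψ : K₀ →+* ℂ) (hψ0 : ψ ≠ φ₀) (hψ1 : ψ ≠ ComplexEmbedding.conjugate φ₀) :
    Fintype.card {σ : (cmTypeOfPair ιF hF).1 // σ.1.comp (algebraMap K₀ F) = ψ} = 0 ∨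
      Fintype.card {σ : (cmTypeOfPair ιF hF).1 // σ.1.comp (algebraMap K₀ F) = ψ} = finrank K₀ F := by
  by_cases hψ : ψ ∈ Φ₀.1
  · exact Or.inl (h0 ψ hψ hψ0)
  · right
    have hψbar : ComplexEmbedding.conjugate ψ ∈ Φ₀.1 := by
      by_contra h
      exact hψ ((Φ₀.2 ψ).2 h)
    have hne' : ComplexEmbedding.conjugate ψ ≠ φ₀ := fun h =>
      hψ1 (by rw [← h]; exact (ComplexEmbedding.involutive_conjugate K₀ ψ).symm)
    have hs := card_fibre_add_card_fibre_conjugate_eq_finrank ιF hF K₀ ψ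
    rw [h0 _ hψbar hne'] at hs
    omega

/-! ### §2 The reflex field of the CM points of this signature -/

section Reflex

variable [IsCMField F] {φ₀ : K₀ →+* ℂ}
  (h1 : Fintype.card {σ : (cmTypeOfPair ιF hF).1 // σ.1.comp (algebraMap K₀ F) = φ₀} = 1)
  (hban : ∀ ψ : K₀ →+* ℂ, ψ ≠ φ₀ → ψ ≠ ComplexEmbedding.conjugate φ₀ →
    Fintype.card {σ : (cmTypeOfPair ιF hF).1 // σ.1.comp (algebraMap K₀ F) = ψ} = 0 ∨
      Fintype.card {σ : (cmTypeOfPair ιF hF).1 // σ.1.comp (algebraMap K₀ F) = ψ} = finrank K₀ F)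

omit [IsCMField F] in
include h1 in
/-- `h1` in the field-level spelling. [folklore] -/
private theorem h1_ncard : {φ : F →+* ℂ | φ ∈ (cmTypeOfPair ιF hF).1 ∧ φ.comp (algebraMap K₀ F) = φ₀}.ncard = 1 := by
  rw [ncard_inter_fibre_eq_card_fibre_ht5 ιF hF K₀, h1]

omit [IsCMField F] in
include hban in
/-- `hban` in the field-level spelling. [folklore] -/
private theorem hban_ncard : ∀ ψ : K₀ →+* ℂ, ψ ≠ φ₀ → ψ ≠ ComplexEmbedding.conjugate φ₀ →
    {φ : F →+* ℂ | φ ∈ (cmTypeOfPair ιF hF).1 ∧ φ.comp (algebraMap K₀ F) = ψ}.ncard = 0 ∨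
      {φ : F →+* ℂ | φ ∈ (cmTypeOfPair ιF hF).1 ∧ φ.comp (algebraMap K₀ F) = ψ}.ncard = finrank K₀ F := by
  intro ψ hψ0 hψ1
  rw [ncard_inter_fibre_eq_card_fibre_ht5 ιF hF K₀]
  exact hban ψ hψ0 hψ1

include h1 hban in
/-- **`σ₀(F) ⊆ K*`: THE REFLEX FIELD OF A CM POINT OF THE HARRIS–TAYLOR / RSZ SIGNATURE CONTAINS `σ₀(F) ≅ F`**
(`n = [F : K₀] ≥ 3`, `σ₀` the special element of THE type above `φ₀`, `F` a CM field) — the field-level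
`fieldRange_le_traceField_of_harrisTaylor` on `Φ = cmTypeOfPair ι hF`. [cite: Howard2012, §3.1 («`K_Φ = φ^{sp}(K)`»)]
[cite: RapoportSmithlingZhang2017, §3.1–3.2] [cite: Shimura1998, §8.3 Prop. 28] -/
theorem fieldRange_special_le_traceField_cmTypeOfPair_of_harrisTaylor (h3 : 3 ≤ finrank K₀ F) {σ₀ : F →+* ℂ}
    (hσ₀ : σ₀ ∈ (cmTypeOfPair ιF hF).1) (hσ₀ψ : σ₀.comp (algebraMap K₀ F) = φ₀) :
    σ₀.toRatAlgHom.fieldRange ≤ traceField (cmTypeOfPair ιF hF) :=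
  fieldRange_le_traceField_of_harrisTaylor K₀ (h1_ncard ιF hF K₀ h1) (hban_ncard ιF hF K₀ hban) h3 hσ₀ hσ₀ψ

include h1 hban in
/-- **`2 dim A = [F : ℚ] ≤ [K* : ℚ]`** for such CM points (`n ≥ 3`). [cite: Howard2012, §3.1]
[cite: RapoportSmithlingZhang2017, §3.1–3.2] -/
theorem two_mul_dim_le_finrank_traceField_of_harrisTaylor (h3 : 3 ≤ finrank K₀ F) :
    2 * A.dim ≤ finrank ℚ (traceField (cmTypeOfPair ιF hF)) := by
  rw [← hF]
  exact finrank_le_finrank_traceField_of_harrisTaylor K₀ (h1_ncard ιF hF K₀ h1) (hban_ncard ιF hF K₀ hban) h3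

include h1 hban in
/-- **`K* = σ₀(F)` for `K₀/ℚ` NORMAL** (e.g. `K₀` imaginary quadratic — Howard —, or a Galois CM field `K₀`), `n ≥ 3`.
[cite: Howard2012, §3.1] [cite: RapoportSmithlingZhang2017, §3.1–3.2] [cite: Shimura1998, §8.3 Prop. 28] -/
theorem traceField_cmTypeOfPair_eq_fieldRange_of_harrisTaylor [Normal ℚ K₀] (h3 : 3 ≤ finrank K₀ F) {σ₀ : F →+* ℂ}
    (hσ₀ : σ₀ ∈ (cmTypeOfPair ιF hF).1) (hσ₀ψ : σ₀.comp (algebraMap K₀ F) = φ₀) :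
    traceField (cmTypeOfPair ιF hF) = σ₀.toRatAlgHom.fieldRange :=
  traceField_eq_fieldRange_of_harrisTaylor_of_normal K₀ (h1_ncard ιF hF K₀ h1) (hban_ncard ιF hF K₀ hban) h3 hσ₀ hσ₀ψ

include h1 hban in
/-- **`[K* : ℚ] = 2 dim A`** for `K₀/ℚ` normal, `n ≥ 3`. [cite: Howard2012, §3.1] -/
theorem finrank_traceField_cmTypeOfPair_eq_two_mul_dim_of_harrisTaylor [Normal ℚ K₀] (h3 : 3 ≤ finrank K₀ F) :
    finrank ℚ (traceField (cmTypeOfPair ιF hF)) = 2 * A.dim := by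
  rw [← hF]
  exact finrank_traceField_eq_finrank_of_harrisTaylor K₀ (h1_ncard ιF hF K₀ h1) (hban_ncard ιF hF K₀ hban) h3
    fun _ ψ hτ => smul_eq_of_smul_eq_of_normal K₀ hτ ψ

include h1 hban in
/-- **`K* ≅ F`** for `K₀/ℚ` normal, `n ≥ 3`. [cite: Howard2012, §3.1] -/
theorem nonempty_ringEquiv_traceField_cmTypeOfPair_of_harrisTaylor [Normal ℚ K₀] (h3 : 3 ≤ finrank K₀ F) :
    Nonempty (F ≃+* traceField (cmTypeOfPair ιF hF)) :=
  nonempty_ringEquiv_traceField_of_harrisTaylor K₀ (h1_ncard ιF hF K₀ h1) (hban_ncard ιF hF K₀ hban) h3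
    fun _ ψ hτ => smul_eq_of_smul_eq_of_normal K₀ hτ ψ

end Reflex

section RSZ

variable [IsCMField F] (Φ₀ : CMType K₀) {φ₀ : K₀ →+* ℂ} (hφ₀ : φ₀ ∈ Φ₀.1)
  (h : ∀ a : K₀, (Motives.AbelianVariety.lieAction A (ιF (algebraMap K₀ F a))).charpoly =
    (X - C (φ₀ a : ℂ)) * ((X - C (ComplexEmbedding.conjugate φ₀ a : ℂ)) ^ (finrank K₀ F - 1) *
      ∏ φ ∈ Φ₀.1.toFinset.erase φ₀, (X - C (ComplexEmbedding.conjugate φ a : ℂ)) ^ finrank K₀ F))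

include hφ₀ h in
/-- **FROM RSZ'S DISPLAYED KOTTWITZ CONDITION: `σ₀(F) ⊆ K*`** (`n ≥ 3`, `F` CM). [cite: RapoportSmithlingZhang2017, §3.1–3.2]
[cite: Howard2012, §3.1] -/
theorem fieldRange_special_le_traceField_cmTypeOfPair_of_rsz (h3 : 3 ≤ finrank K₀ F) {σ₀ : F →+* ℂ}
    (hσ₀ : σ₀ ∈ (cmTypeOfPair ιF hF).1) (hσ₀ψ : σ₀.comp (algebraMap K₀ F) = φ₀) :
    σ₀.toRatAlgHom.fieldRange ≤ traceField (cmTypeOfPair ιF hF) := by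
  obtain ⟨h1, h0⟩ := (forall_charpoly_lieAction_eq_rsz_iff ιF hF K₀ Φ₀ hφ₀).1 h
  exact fieldRange_special_le_traceField_cmTypeOfPair_of_harrisTaylor ιF hF K₀ h1
    (card_fibre_eq_zero_or_of_rsz ιF hF K₀ Φ₀ h0) h3 hσ₀ hσ₀ψ

include hφ₀ h in
/-- **… and `K* = σ₀(F)` for `K₀/ℚ` normal** (`n ≥ 3`). [cite: RapoportSmithlingZhang2017, §3.1–3.2] [cite: Howard2012, §3.1] -/
theorem traceField_cmTypeOfPair_eq_fieldRange_of_rsz [Normal ℚ K₀] (h3 : 3 ≤ finrank K₀ F) {σ₀ : F →+* ℂ}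
    (hσ₀ : σ₀ ∈ (cmTypeOfPair ιF hF).1) (hσ₀ψ : σ₀.comp (algebraMap K₀ F) = φ₀) :
    traceField (cmTypeOfPair ιF hF) = σ₀.toRatAlgHom.fieldRange := by
  obtain ⟨h1, h0⟩ := (forall_charpoly_lieAction_eq_rsz_iff ιF hF K₀ Φ₀ hφ₀).1 h
  exact traceField_cmTypeOfPair_eq_fieldRange_of_harrisTaylor ιF hF K₀ h1
    (card_fibre_eq_zero_or_of_rsz ιF hF K₀ Φ₀ h0) h3 hσ₀ hσ₀ψ

omit [IsCMField F] in
include hφ₀ h in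
/-- **… with a special element to apply them to**: the condition provides `σ₀ ∈ Φ` above `φ₀`, unique.
[cite: RapoportSmithlingZhang2017, §3.2] [cite: Howard2012, §3.1] -/
theorem exists_special_of_rsz :
    ∃ σ₀ ∈ (cmTypeOfPair ιF hF).1, σ₀.comp (algebraMap K₀ F) = φ₀ ∧
      ∀ φ ∈ (cmTypeOfPair ιF hF).1, φ.comp (algebraMap K₀ F) = σ₀.comp (algebraMap K₀ F) → φ = σ₀ :=
  exists_special_of_card_fibre_eq_one ιF hF K₀ ((forall_charpoly_lieAction_eq_rsz_iff ιF hF K₀ Φ₀ hφ₀).1 h).1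

include hφ₀ h hF in
/-- **… hence `2 dim A ≤ [K* : ℚ]`, with equality for `K₀/ℚ` normal** (`n ≥ 3`).
[cite: RapoportSmithlingZhang2017, §3.1–3.2] [cite: Howard2012, §3.1] -/
theorem two_mul_dim_le_finrank_traceField_of_rsz (h3 : 3 ≤ finrank K₀ F) :
    2 * A.dim ≤ finrank ℚ (traceField (cmTypeOfPair ιF hF)) := by
  obtain ⟨h1, h0⟩ := (forall_charpoly_lieAction_eq_rsz_iff ιF hF K₀ Φ₀ hφ₀).1 h
  exact two_mul_dim_le_finrank_traceField_of_harrisTaylor ιF hF K₀ h1 (card_fibre_eq_zero_or_of_rsz ιF hF K₀ Φ₀ h0) h3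

end RSZ

end EndFieldFullDegree

end Literature.AlgebraicGeometry.ComplexMultiplication

end
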